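import Mathlib
import HarnessLib

/-!
# Hochschild's formula for the `p`-th power of a rescaled derivation

Topic: `Literature/RingTheory/Derivation`. Let `A` be a commutative algebra of prime
characteristic `p` over a commutative ring `R`, `D` an `R`-derivation of `A` and `g ∈ A`. Then
**Hochschild's formula** [Hochschild1955, Lemma 1; Matsumura, *Commutative Ring Theory*,
Thm. 25.5] computes the `p`-th power of the rescaled derivation `g • D`:

  `(g • D)^[p] x = g ^ p · D^[p] x + ((g • D)^[p-1] g) · D x`
  (`Derivation.hochschild_iterate_smul`).

In particular `(g D)^p ∈ A · D^p + A · D`, so `p`-closedness (`D^[p] = c · D`) of a derivation of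
a field is stable under rescaling (`Derivation.exists_iterate_smul_eq_mul`).

Proof (Hochschild's universal-derivation trick, all elementary, namespace `….Hochschild`):
* `normalForm`: `(g • D)^[n] = ∑_{i ≤ n} β i · D^[i]` with `β 0 = 0`, `β n = g ^ n`,
  `β 1 = (g • D)^[n-1] g`, the `β i` lying in any subset containing `0, g` and closed under
  `+, *, D` (induction on `n`); `middleSum` isolates the middle terms `2 ≤ i < p`;
* `iterate_apply_mul` / `iterate_prime_apply_mul`: the general Leibniz rule for `D^[n] (x y)`;
  in characteristic `p` the middle binomials vanish, so `D^[p]`, `(g • D)^[p]` and hence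
  `E := (g • D)^[p] - g^p D^[p] - ((g • D)^[p-1] g) D = ∑_{2 ≤ i < p} β i · D^[i]` satisfy the
  Leibniz rule;
* `exists_extension`: `D` extends to an `R`-derivation `D'` of `A[X₀, X₁, X₂, …]`
  (coefficientwise `D` plus the `A`-derivation `X₀ ↦ 1`, `X_{j+1} ↦ X_{j+2}`); running the
  above for `C g • D'` (the `β i` are then constants `C (b i)`), the Leibniz defect of `E` at
  `X₀ · X₁` is `∑ C (b i) · i · X_i = 0` (`generic_defect`), whence `i · b i = 0`, so `b i = 0`
  for `2 ≤ i < p` (`i` is a unit mod `p`), i.e. `E = 0` on `A[X] ⊇ A`.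

An additive map `D : A → A` with the Leibniz rule is the same as a `ℤ`-derivation
(`Derivation.mk'` with `AddMonoidHom.toIntLinearMap`), so nothing is lost by the bundled form.
`Derivation.hochschild_iterate_smul` and `Derivation.exists_iterate_smul_eq_mul` are deliberate
dot-notation extensions of Mathlib's `Derivation` namespace.

References: G. Hochschild, *Simple algebras with purely inseparable splitting fields of
exponent 1*, Trans. AMS 79 (1955), Lemma 1; H. Matsumura, *Commutative Ring Theory*, CUP 1986,
Thm. 25.5. (Bundled port of the route-side development in
`Summits/ResolutionOfSingularities/…/Theorems/FoliationDescentFolLUStubRescalePClosed.lean`.)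
No named facts.
-/

noncomputable section

open MvPolynomial Finset

namespace Literature.RingTheory.Derivation

namespace Hochschild

section General

variable {R B : Type*} [CommRing R] [CommRing B] [Algebra R B]

/-- **General Leibniz rule** for the iterates of a derivation:
`D^[n] (x y) = ∑_{i + j = n} (n choose i) D^[i] x · D^[j] y`. [folklore] -/
theorem iterate_apply_mul (D : _root_.Derivation R B B) (n : ℕ) (x y : B) :
    (⇑D)^[n] (x * y) =
      ∑ ij ∈ antidiagonal n, n.choose ij.1 • ((⇑D)^[ij.1] x * (⇑D)^[ij.2] y) := by
  have hD : ∀ x y, D (x * y) = x * D y + y * D x := fun x y => by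
    rw [Derivation.leibniz, smul_eq_mul, smul_eq_mul]
  induction n with
  | zero => simp
  | succ n ih =>
    rw [sum_antidiagonal_choose_succ_nsmul (M := B) (fun i j => (⇑D)^[i] x * (⇑D)^[j] y) n,
      Function.iterate_succ_apply', ih, map_sum]
    simp only [map_nsmul, hD, smul_add, sum_add_distrib, Function.iterate_succ_apply']
    congr 1
    refine sum_congr rfl fun ij hij => ?_
    rw [Nat.choose_symm_of_eq_add (Finset.HasAntidiagonal.mem_antidiagonal.1 hij).symm, mul_comm]

/-- **The `p`-th iterate of a derivation is a derivation in characteristic `p`**: the middle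
binomial coefficients `p choose i`, `0 < i < p`, vanish. [folklore] -/
theorem iterate_prime_apply_mul {p : ℕ} (hp : p.Prime) [CharP B p] (D : _root_.Derivation R B B)
    (x y : B) : (⇑D)^[p] (x * y) = x * (⇑D)^[p] y + y * (⇑D)^[p] x := by
  obtain ⟨m, rfl⟩ := Nat.exists_eq_add_of_le' hp.two_le
  rw [iterate_apply_mul D, Nat.sum_antidiagonal_succ, Nat.sum_antidiagonal_succ',
    sum_eq_zero (s := antidiagonal m)]
  · simp [mul_comm]
  · intro ij hij
    rw [Finset.HasAntidiagonal.mem_antidiagonal] at hij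
    have hdvd : m + 2 ∣ (m + 2).choose (ij.1 + 1) :=
      hp.dvd_choose_self (Nat.succ_ne_zero _) (by omega)
    rw [nsmul_eq_mul, (CharP.cast_eq_zero_iff B (m + 2) _).2 hdvd, zero_mul]

/-- **Normal form of the iterates of a rescaled derivation.** For `n ≥ 1`:
`(g • D)^[n] = ∑_{i ≤ n} β i · D^[i]` with `β 0 = 0`, `β n = g ^ n`, `β 1 = (g • D)^[n-1] g`,
`β i = 0` for `i > n`, and all `β i` in any subset `P ∋ 0, g` closed under `+`, `*` and `D`
(the recursion is `β' i = g (D (β i) + β (i-1))`). [cite: Hochschild1955, Lemma 1] -/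
theorem normalForm (D : _root_.Derivation R B B) (g : B) (P : B → Prop) (hP0 : P 0)
    (hPadd : ∀ a b, P a → P b → P (a + b)) (hPmul : ∀ a b, P a → P b → P (a * b))
    (hPD : ∀ a, P a → P (D a)) (hPg : P g) (n : ℕ) (hn : 1 ≤ n) :
    ∃ β : ℕ → B, (∀ i, P (β i)) ∧ β 0 = 0 ∧ β n = g ^ n ∧ β 1 = (⇑(g • D))^[n - 1] g ∧
      (∀ i, n < i → β i = 0) ∧
      ∀ y, (⇑(g • D))^[n] y = ∑ i ∈ range (n + 1), β i * (⇑D)^[i] y := by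
  have hD : ∀ x y, D (x * y) = x * D y + y * D x := fun x y => by
    rw [Derivation.leibniz, smul_eq_mul, smul_eq_mul]
  have hδ : ∀ y, (g • D) y = g * D y := fun y => by rw [Derivation.smul_apply, smul_eq_mul]
  induction n, hn using Nat.le_induction with
  | base =>
    refine ⟨fun i => if i = 1 then g else 0, fun i => ?_, by simp, by simp, by simp,
      fun i hi => ?_, fun y => ?_⟩
    · dsimp only
      split_ifs
      exacts [hPg, hP0]
    · simp [show i ≠ 1 by omega]
    · simp
  | succ n hn ih =>
    obtain ⟨β, hP, h0, htop, h1, hvan, hsum⟩ := ih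
    refine ⟨fun i => g * D (β i) + if i = 0 then 0 else g * β (i - 1), fun i => ?_, ?_, ?_, ?_,
      fun i hi => ?_, fun y => ?_⟩
    · refine hPadd _ _ (hPmul _ _ hPg (hPD _ (hP i))) ?_
      split_ifs
      exacts [hP0, hPmul _ _ hPg (hP _)]
    · simp [h0]
    · dsimp only
      rw [hvan (n + 1) (lt_add_one n), map_zero, mul_zero, zero_add, if_neg (Nat.succ_ne_zero n),
        Nat.add_sub_cancel, htop]
      exact (pow_succ' g n).symm
    · have e : (⇑(g • D))^[n] g = (g • D) ((⇑(g • D))^[n - 1] g) := by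
        obtain ⟨n', rfl⟩ : ∃ n', n = n' + 1 := ⟨n - 1, (Nat.sub_add_cancel hn).symm⟩
        rw [Nat.add_sub_cancel, Function.iterate_succ_apply']
      dsimp only
      rw [if_neg one_ne_zero, Nat.sub_self, h0, mul_zero, add_zero, h1, Nat.add_sub_cancel, ← hδ, e]
    · dsimp only
      rw [hvan i (by omega), hvan (i - 1) (by omega), map_zero, mul_zero, zero_add, ite_self]
    · have key : ∑ i ∈ range (n + 1), g * D (β i) * (⇑D)^[i] y =
          ∑ i ∈ range (n + 1), g * D (β (i + 1)) * (⇑D)^[i + 1] y := by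
        have e1 : ∑ i ∈ range (n + 1 + 1), g * D (β i) * (⇑D)^[i] y =
            ∑ i ∈ range (n + 1), g * D (β i) * (⇑D)^[i] y := by
          rw [sum_range_succ _ (n + 1), hvan (n + 1) (lt_add_one n), map_zero, mul_zero, zero_mul,
            add_zero]
        have e2 : ∑ i ∈ range (n + 1 + 1), g * D (β i) * (⇑D)^[i] y =
            ∑ i ∈ range (n + 1), g * D (β (i + 1)) * (⇑D)^[i + 1] y := by
          rw [sum_range_succ' _ (n + 1), h0, map_zero, mul_zero, zero_mul, add_zero]
        rw [← e1, e2]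
      rw [Function.iterate_succ_apply', hsum, hδ, map_sum, mul_sum, sum_range_succ' _ (n + 1)]
      simp only [Nat.succ_ne_zero, if_false, if_true, Nat.add_sub_cancel, h0, map_zero,
        mul_zero, add_zero, zero_mul]
      calc ∑ i ∈ range (n + 1), g * D (β i * (⇑D)^[i] y)
          = ∑ i ∈ range (n + 1), g * β i * (⇑D)^[i + 1] y +
              ∑ i ∈ range (n + 1), g * D (β i) * (⇑D)^[i] y := by
            rw [← sum_add_distrib]
            refine sum_congr rfl fun i _ => ?_
            rw [hD, Function.iterate_succ_apply']
            ring
        _ = ∑ i ∈ range (n + 1), g * β i * (⇑D)^[i + 1] y +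
              ∑ i ∈ range (n + 1), g * D (β (i + 1)) * (⇑D)^[i + 1] y := by rw [key]
        _ = ∑ i ∈ range (n + 1), (g * D (β (i + 1)) + g * β i) * (⇑D)^[i + 1] y := by
            rw [← sum_add_distrib]
            refine sum_congr rfl fun i _ => ?_
            ring

/-- The `p`-th normal form rearranged: `E := (g • D)^[p] - g^p D^[p] - ((g • D)^[p-1] g) D` is
the combination `∑_{2 ≤ i < p} β i · D^[i]` of the MIDDLE iterates, with the `β i` in any
subset `P ∋ 0, g` closed under `+`, `*`, `D`. [cite: Hochschild1955, Lemma 1] -/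
theorem middleSum (D : _root_.Derivation R B B) (g : B) (P : B → Prop) (hP0 : P 0)
    (hPadd : ∀ a b, P a → P b → P (a + b)) (hPmul : ∀ a b, P a → P b → P (a * b))
    (hPD : ∀ a, P a → P (D a)) (hPg : P g) (p : ℕ) (hp : 2 ≤ p) :
    ∃ β : ℕ → B, (∀ i, P (β i)) ∧
      ∀ y, (⇑(g • D))^[p] y - g ^ p * (⇑D)^[p] y - (⇑(g • D))^[p - 1] g * D y =
        ∑ i ∈ Ico 2 p, β i * (⇑D)^[i] y := by
  obtain ⟨β, hP, h0, htop, h1, -, hsum⟩ := normalForm D g P hP0 hPadd hPmul hPD hPg p (by omega)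
  refine ⟨β, hP, fun y => ?_⟩
  rw [hsum, sum_range_succ, sum_range_eq_add_Ico _ (by omega : 0 < p),
    sum_eq_sum_Ico_succ_bot (by omega : 1 < p), h0, htop, h1]
  simp only [zero_mul, zero_add, Function.iterate_one]
  ring

end General

section Universal

variable {R A : Type*} [CommRing R] [CommRing A] [Algebra R A]

/-- **The universal extension.** An `R`-derivation `D` of `A` extends to an `R`-derivation `D'`
of `A[X₀, X₁, …]` with `D' (C a) = C (D a)`, `D' X₀ = 1` and `D' X_{j+1} = X_{j+2}`: the sum of
the coefficientwise action of `D` and of the `A`-derivation with the prescribed values on the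
variables. [cite: Hochschild1955, Lemma 1] -/
theorem exists_extension (D : _root_.Derivation R A A) :
    ∃ D' : _root_.Derivation R (MvPolynomial ℕ A) (MvPolynomial ℕ A),
      (∀ a, D' (C a) = C (D a)) ∧ D' (X 0) = 1 ∧ ∀ j, D' (X (j + 1)) = X (j + 2) := by
  classical
  have hD : ∀ x y, D (x * y) = x * D y + y * D x := fun x y => by
    rw [Derivation.leibniz, smul_eq_mul, smul_eq_mul]
  -- the coefficientwise action of `D`
  let Dc : MvPolynomial ℕ A →+ MvPolynomial ℕ A :=
    { toFun := AddMonoidAlgebra.map (D : A →+ A)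
      map_zero' := AddMonoidAlgebra.map_zero _
      map_add' := AddMonoidAlgebra.map_add _ }
  have hc : ∀ m q, coeff m (Dc q) = D (coeff m q) := fun _ _ => rfl
  have hsmul : ∀ (r : R) (q : MvPolynomial ℕ A), Dc (r • q) = (RingHom.id R) r • Dc q := by
    intro r q
    refine MvPolynomial.ext _ _ fun m => ?_
    rw [RingHom.id_apply, coeff_smul, hc, hc, coeff_smul, D.map_smul]
  have hcm : ∀ x y, Dc (x * y) = x • Dc y + y • Dc x := by
    intro x y
    refine MvPolynomial.ext _ _ fun m => ?_
    rw [smul_eq_mul, smul_eq_mul, mul_comm y (Dc x), coeff_add, hc, coeff_mul, coeff_mul,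
      coeff_mul, map_sum]
    simp only [hD, hc, sum_add_distrib]
    exact congr_arg₂ (· + ·) rfl (sum_congr rfl fun _ _ => mul_comm _ _)
  let Dc' : _root_.Derivation R (MvPolynomial ℕ A) (MvPolynomial ℕ A) :=
    Derivation.mk' { toFun := Dc, map_add' := map_add Dc, map_smul' := hsmul } hcm
  have hc' : ∀ m q, coeff m (Dc' q) = D (coeff m q) := fun _ _ => rfl
  have hcC : ∀ a, Dc' (C a) = C (D a) := fun a => by
    refine MvPolynomial.ext _ _ fun m => ?_
    rw [hc', coeff_C, coeff_C]
    split_ifs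
    · rfl
    · exact map_zero D
  have hcX : ∀ n, Dc' (X n) = 0 := fun n => by
    refine MvPolynomial.ext _ _ fun m => ?_
    rw [hc', coeff_X, coeff_zero]
    split_ifs
    · exact D.map_one_eq_zero
    · exact map_zero D
  -- the `A`-derivation with prescribed values on the variables
  let Dx : _root_.Derivation R (MvPolynomial ℕ A) (MvPolynomial ℕ A) :=
    (mkDerivation A fun n => if n = 0 then (1 : MvPolynomial ℕ A) else X (n + 1)).restrictScalars R
  have hx : ∀ n, Dx (X n) = if n = 0 then (1 : MvPolynomial ℕ A) else X (n + 1) := fun n =>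
    mkDerivation_X _ _ _
  have hxC : ∀ a, Dx (C a) = 0 := fun a => derivation_C _ _
  have hadd : ∀ q, (Dc' + Dx) q = Dc' q + Dx q := fun q => rfl
  refine ⟨Dc' + Dx, fun a => ?_, ?_, fun j => ?_⟩
  · rw [hadd, hcC, hxC, add_zero]
  · rw [hadd, hcX, hx, if_pos rfl, zero_add]
  · rw [hadd, hcX, hx, if_neg (Nat.succ_ne_zero j), zero_add]

/-- **The generic Leibniz defect.** For a derivation `D'` of `A[X₀, X₁, …]` with `D' X₀ = 1`,
`D' X_{j+1} = X_{j+2}` and `i ≥ 2`: `D'^[i] (X₀ X₁) - X₀ D'^[i] X₁ - X₁ D'^[i] X₀ = i · X_i`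
(only the term `(i choose 1) D' X₀ · D'^[i-1] X₁` of the general Leibniz rule survives).
[cite: Hochschild1955, Lemma 1] -/
theorem generic_defect (D' : _root_.Derivation R (MvPolynomial ℕ A) (MvPolynomial ℕ A))
    (h0 : D' (X 0) = 1) (h1 : ∀ j, D' (X (j + 1)) = X (j + 2)) (i : ℕ) (hi : 2 ≤ i) :
    (⇑D')^[i] (X 0 * X 1) - X 0 * (⇑D')^[i] (X 1) - X 1 * (⇑D')^[i] (X 0) =
      (i : MvPolynomial ℕ A) * X i := by
  have hX1 : ∀ n, (⇑D')^[n] (X 1) = X (n + 1) := by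
    intro n
    induction n with
    | zero => rfl
    | succ n ih => rw [Function.iterate_succ_apply', ih, h1]
  have hX0 : ∀ n, (⇑D')^[n + 1 + 1] (X 0) = 0 := by
    intro n
    rw [Function.iterate_succ_apply, Function.iterate_succ_apply, h0, D'.map_one_eq_zero,
      iterate_map_zero]
  obtain ⟨m, rfl⟩ := Nat.exists_eq_add_of_le' hi
  rw [iterate_apply_mul D', Nat.sum_antidiagonal_succ, Nat.sum_antidiagonal_succ,
    sum_eq_zero (s := antidiagonal m) fun ij _ => by rw [hX0, zero_mul, smul_zero]]
  have e2 : m + 2 = m + 1 + 1 := rfl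
  simp only [e2, hX0, hX1, zero_add, Function.iterate_one, h0, Nat.choose_zero_right,
    Nat.choose_one_right, one_smul, Function.iterate_zero_apply, one_mul, add_zero, mul_zero,
    sub_zero, add_sub_cancel_left, nsmul_eq_mul]

end Universal

end Hochschild

/-! ### Hochschild's formula and the rescaling corollary -/

section Formula

open Hochschild

variable {R A : Type*} [CommRing R] [CommRing A] [Algebra R A]

/-- **Hochschild's formula** [Hochschild1955, Lemma 1; Matsumura, *Commutative Ring Theory*,
Thm. 25.5]. For an `R`-derivation `D` of a commutative `R`-algebra `A` of prime characteristic
`p`, `g ∈ A` and all `x`: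
`(g • D)^[p] x = g ^ p · D^[p] x + ((g • D)^[p-1] g) · D x`;
in particular `(g D)^p ∈ A · D^p + A · D`.
(Deliberate dot-notation extension of Mathlib's `Derivation` namespace.)
[cite: Hochschild1955, Lemma 1] -/
theorem _root_.Derivation.hochschild_iterate_smul {p : ℕ} (hp : p.Prime) [CharP A p]
    (D : _root_.Derivation R A A) (g x : A) :
    (⇑(g • D))^[p] x = g ^ p * (⇑D)^[p] x + (⇑(g • D))^[p - 1] g * D x := by
  classical
  obtain ⟨D', hC, hX0, hX1⟩ := exists_extension D
  have hD' : ∀ x y, D' (x * y) = x * D' y + y * D' x := fun x y => by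
    rw [Derivation.leibniz, smul_eq_mul, smul_eq_mul]
  have hδ : ∀ y, (g • D) y = g * D y := fun y => by rw [Derivation.smul_apply, smul_eq_mul]
  have hδ' : ∀ w, ((C g : MvPolynomial ℕ A) • D') w = C g * D' w := fun w => by
    rw [Derivation.smul_apply, smul_eq_mul]
  have hDn : ∀ n a, (⇑D')^[n] (C a) = C ((⇑D)^[n] a) := by
    intro n
    induction n with
    | zero => intro a; rfl
    | succ n ih =>
      intro a
      rw [Function.iterate_succ_apply', ih, hC, Function.iterate_succ_apply']
  have hδn : ∀ n a, (⇑((C g : MvPolynomial ℕ A) • D'))^[n] (C a) = C ((⇑(g • D))^[n] a) := by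
    intro n
    induction n with
    | zero => intro a; rfl
    | succ n ih =>
      intro a
      rw [Function.iterate_succ_apply', ih, hδ', hC, ← map_mul, ← hδ, Function.iterate_succ_apply']
  obtain ⟨β, hP, hE⟩ := middleSum D' (C g) (fun w => ∃ a, w = C a)
    ⟨0, (map_zero C).symm⟩ (by rintro _ _ ⟨a, rfl⟩ ⟨b, rfl⟩; exact ⟨a + b, (map_add C a b).symm⟩)
    (by rintro _ _ ⟨a, rfl⟩ ⟨b, rfl⟩; exact ⟨a * b, (map_mul C a b).symm⟩)
    (by rintro _ ⟨a, rfl⟩; exact ⟨D a, hC a⟩) ⟨g, rfl⟩ p hp.two_le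
  choose b hb using hP
  -- the Leibniz defect of `E` vanishes; evaluate it at the generic pair `X₀ · X₁`
  have hdef : ∀ y z : MvPolynomial ℕ A,
      (∑ i ∈ Ico 2 p, β i * (⇑D')^[i] (y * z)) - y * (∑ i ∈ Ico 2 p, β i * (⇑D')^[i] z) -
        z * (∑ i ∈ Ico 2 p, β i * (⇑D')^[i] y) = 0 := by
    intro y z
    rw [← hE, ← hE, ← hE, iterate_prime_apply_mul hp ((C g : MvPolynomial ℕ A) • D') y z,
      iterate_prime_apply_mul hp D' y z, hD' y z]
    ring
  have key : ∑ i ∈ Ico 2 p, C (b i) * ((i : MvPolynomial ℕ A) * X i) = 0 := by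
    rw [← hdef (X 0) (X 1)]
    simp only [mul_sum, ← sum_sub_distrib]
    refine sum_congr rfl fun i hi => ?_
    rw [← generic_defect D' hX0 hX1 i (mem_Ico.1 hi).1, hb i]
    ring
  -- extract the coefficient of `X_i`: `b i · i = 0`, and `i` is a unit modulo `p`
  have hcoeff : ∀ i ∈ Ico 2 p,
      coeff (Finsupp.single i 1) (∑ j ∈ Ico 2 p, C (b j) * ((j : MvPolynomial ℕ A) * X j)) =
        b i * i := by
    intro i hi
    rw [coeff_sum]
    simp_rw [← mul_assoc, ← map_natCast (C : A →+* MvPolynomial ℕ A), ← map_mul, coeff_C_mul,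
      coeff_X, Finsupp.single_left_inj one_ne_zero, mul_ite, mul_one, mul_zero]
    rw [sum_ite_eq' _ i, if_pos hi]
  have hb0 : ∀ i ∈ Ico 2 p, b i = 0 := by
    intro i hi
    obtain ⟨h2i, hip⟩ := mem_Ico.1 hi
    have hc := hcoeff i hi
    rw [key, coeff_zero] at hc
    have hu : IsUnit ((i : ℕ) : A) :=
      (CharP.isUnit_natCast_iff (R := A) hp).2 (Nat.not_dvd_of_pos_of_lt (by omega) hip)
    exact (hu.mul_left_eq_zero.1 hc.symm)
  -- specialise `E = 0` to the constant `C x`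
  have hfin := hE (C x)
  rw [sum_eq_zero fun i hi => by rw [hb i, hb0 i hi, map_zero, zero_mul], hδn, hDn, hδn, hC,
    ← map_pow C, ← map_mul C, ← map_mul C, ← map_sub C, ← map_sub C, C_eq_zero, sub_sub,
    sub_eq_zero] at hfin
  exact hfin

/-- **`p`-closedness is stable under rescaling.** If `D` is an `R`-derivation of a field `K`
of characteristic `p` with `D^[p] = c · D` for some `c ∈ K` (`D` is *`p`-closed*), then for
every `g ∈ K` the rescaled derivation `g • D` is again `p`-closed:
`(g • D)^[p] = c' · (g • D)` with `c' := (g ^ p c + (g • D)^[p-1] g) / g` (`c' := 0` if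
`g = 0`), by Hochschild's formula. (Deliberate dot-notation extension of Mathlib's `Derivation`
namespace.) [cite: Hochschild1955, Lemma 1] -/
theorem _root_.Derivation.exists_iterate_smul_eq_mul {K : Type*} [Field K] [Algebra R K]
    {p : ℕ} (hp : p.Prime) [CharP K p] (D : _root_.Derivation R K K)
    (hD : ∃ c : K, ∀ x : K, (⇑D)^[p] x = c * D x) (g : K) :
    ∃ c' : K, ∀ x : K, (⇑(g • D))^[p] x = c' * (g • D) x := by
  obtain ⟨c, hc⟩ := hD
  have hδ : ∀ y : K, (g • D) y = g * D y := fun y => by rw [Derivation.smul_apply, smul_eq_mul]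
  have H : ∀ x : K, (⇑(g • D))^[p] x = g ^ p * (⇑D)^[p] x + (⇑(g • D))^[p - 1] g * D x :=
    D.hochschild_iterate_smul hp g
  by_cases hg : g = 0
  · refine ⟨0, fun x => ?_⟩
    rw [H x, hg, zero_pow hp.ne_zero, zero_mul, zero_mul, zero_add, iterate_map_zero, zero_mul]
  · refine ⟨(g ^ p * c + (⇑(g • D))^[p - 1] g) / g, fun x => ?_⟩
    have e : (g ^ p * c + (⇑(g • D))^[p - 1] g) / g * (g * D x) =
        (g ^ p * c + (⇑(g • D))^[p - 1] g) * D x := by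
      rw [← mul_assoc, div_mul_cancel₀ _ hg]
    rw [H x, hc, hδ, e]
    ring

end Formula

end Literature.RingTheory.Derivation

end
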